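import Literature.AlgebraicGeometry.HodgeTheory.SemiregularVariationalHodgeTwistedPerfect
import HarnessLib

/-!
# `χ` and `ch` of bounded complexes of vector bundles agree along ZIGZAGS of chain quasi-isomorphisms through bounded VB complexes

Layer `Literature/AlgebraicGeometry/HodgeTheory` (0 named facts, no instances). Items (s1)+(s2) of the cell `pub-hodge-ring2` (LEAD 169
l.6533; director-hodge g22 R19.140 «GO (s1)(s2)») read, for the record, as follows against the TREE:

* (s1) «an acyclic bounded complex of finite locally free modules has class `0`» IS the tree's
  `KTheory/EulerCharacteristic.IsBoundedVBComplex.eulerChar_eq_zero_of_acyclic` (kernels are vector bundles: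
  `IsBoundedVBComplex.isFiniteLocallyFree_kernel`; `χ` telescopes) — nothing to add;
* (s2) «the cone of a chain quasi-isomorphism of bounded VB complexes is a bounded acyclic VB complex, hence `χ`∕`ch` agree» IS the tree's
  `IsBoundedVBComplex.mappingCone` + `acyclic_mappingCone_of_quasiIso` + `eulerChar_mappingCone` ⇒ `IsBoundedVBComplex.eulerChar_eq_of_quasiIso`
  and `HodgeTheory.chPerfect_eq_of_quasiIso` — for ONE chain quasi-isomorphism.

What this file ADDS is only the ZIGZAG packaging J asked for by name: for a roof `K ⟵ L ⟶ K′` or a co-roof `K ⟶ L ⟵ K′` of chain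
quasi-isomorphisms with `L` ALSO a bounded complex of vector bundles, `χ(K) = χ(K′)` in `K₀(X)` (`eulerChar_eq_of_roof`, `eulerChar_eq_of_coroof`)
and `ch_k(K) = ch_k(K′)` (`chPerfect_eq_of_roof`, `chPerfect_eq_of_coroof`). HONEST SCOPE (the seat's own finding, bus l.6537, which retired
the «(k3)-restricted» variant, req-86 M1 (b) WITHDRAWN): this covers ONLY models linked through bounded VB complexes; two bounded VB models of one
object of `D⁺(Mod 𝒪_X)` are in general linked by a roof whose apex is merely bounded-above coherent ∕ K-injective, and replacing it by a VB
complex is the resolution property ((s3), a displayed fact on the day (k3) is declared) — NOT proved here. Research route conditional on HC_CM;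
not a corollary; nothing here refers to 26512, №4, HC_AV, HC_CM or HC.

## References

* M. Schlichting, *Higher algebraic K-theory*, LNM 2008 (2011), §3.1.3–3.1.4 and Exercise 3.1.4 (`K₀` of bounded complexes in an exact category). [Schlichting2011HigherKTheory]
* W. Fulton, *Intersection Theory* (1998), §15.1 (Chern character of perfect complexes). [Fulton1998]
-/

noncomputable section

open CategoryTheory CategoryTheory.Limits AlgebraicGeometry

universe u

/-! ### §1 `χ` along roofs and co-roofs -/

namespace Literature.AlgebraicGeometry.KTheory.IsBoundedVBComplex

variable {X : Scheme.{u}} {K L K' : CochainComplex X.Modules ℤ}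

/-- **`χ(K) = χ(K′)` for a roof `K ⟵ L ⟶ K′`** of chain quasi-isomorphisms of bounded complexes of vector bundles (apex `L` a bounded VB
complex too). [cite: Schlichting2011HigherKTheory, §3.1.3–3.1.4 and Exercise 3.1.4] -/
theorem eulerChar_eq_of_roof (hK : IsBoundedVBComplex K) (hL : IsBoundedVBComplex L) (hK' : IsBoundedVBComplex K')
    (φ : L ⟶ K) (ψ : L ⟶ K') [QuasiIso φ] [QuasiIso ψ] :
    eulerChar K hK.isFiniteLocallyFree = eulerChar K' hK'.isFiniteLocallyFree := by
  rw [← hL.eulerChar_eq_of_quasiIso hK φ, hL.eulerChar_eq_of_quasiIso hK' ψ]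

/-- **`χ(K) = χ(K′)` for a co-roof `K ⟶ L ⟵ K′`** of chain quasi-isomorphisms of bounded complexes of vector bundles.
[cite: Schlichting2011HigherKTheory, §3.1.3–3.1.4 and Exercise 3.1.4] -/
theorem eulerChar_eq_of_coroof (hK : IsBoundedVBComplex K) (hL : IsBoundedVBComplex L) (hK' : IsBoundedVBComplex K')
    (φ : K ⟶ L) (ψ : K' ⟶ L) [QuasiIso φ] [QuasiIso ψ] :
    eulerChar K hK.isFiniteLocallyFree = eulerChar K' hK'.isFiniteLocallyFree := by
  rw [hK.eulerChar_eq_of_quasiIso hL φ, hK'.eulerChar_eq_of_quasiIso hL ψ]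

end Literature.AlgebraicGeometry.KTheory.IsBoundedVBComplex

/-! ### §2 `ch_k` along roofs and co-roofs -/

namespace Literature.AlgebraicGeometry.HodgeTheory

open Literature.AlgebraicGeometry.Motives Literature.AlgebraicGeometry.KTheory

variable (C : ChernCharacterBetti) (X : SchemeOver ℂ) {K L K' : CochainComplex X.left.Modules ℤ}

/-- **`ch_k(K) = ch_k(K′)` for a roof `K ⟵ L ⟶ K′`** of chain quasi-isomorphisms through a bounded VB complex `L`. [cite: Fulton1998, §15.1]
[cite: Schlichting2011HigherKTheory, Exercise 3.1.4] -/
theorem chPerfect_eq_of_roof (hK : IsBoundedVBComplex K) (hL : IsBoundedVBComplex L) (hK' : IsBoundedVBComplex K')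
    (φ : L ⟶ K) (ψ : L ⟶ K') [QuasiIso φ] [QuasiIso ψ] (k : ℕ) :
    chPerfect C X K hK.isFiniteLocallyFree k = chPerfect C X K' hK'.isFiniteLocallyFree k := by
  rw [← chPerfect_eq_of_quasiIso C X hL hK φ k, chPerfect_eq_of_quasiIso C X hL hK' ψ k]

/-- **`ch_k(K) = ch_k(K′)` for a co-roof `K ⟶ L ⟵ K′`** of chain quasi-isomorphisms through a bounded VB complex `L`. [cite: Fulton1998, §15.1]
[cite: Schlichting2011HigherKTheory, Exercise 3.1.4] -/
theorem chPerfect_eq_of_coroof (hK : IsBoundedVBComplex K) (hL : IsBoundedVBComplex L) (hK' : IsBoundedVBComplex K')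
    (φ : K ⟶ L) (ψ : K' ⟶ L) [QuasiIso φ] [QuasiIso ψ] (k : ℕ) :
    chPerfect C X K hK.isFiniteLocallyFree k = chPerfect C X K' hK'.isFiniteLocallyFree k := by
  rw [chPerfect_eq_of_quasiIso C X hK hL φ k, chPerfect_eq_of_quasiIso C X hK' hL ψ k]

end Literature.AlgebraicGeometry.HodgeTheory

end
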